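import Literature.MathematicalPhysics.QuantumLattice.TubeCovarianceTransport
import Mathlib.MeasureTheory.Measure.Haar.Unique
import HarnessLib

/-!
# The PCT substitution `(z₀, …, z_{n−1}) ↦ (−z_{n−1}, …, −z₀)` on tube functions and test functions

Topic `Literature/MathematicalPhysics/QuantumLattice` (trunk T-AQFT). In the PCT theorem
(Streater–Wightman (1964), §4-3, Thm. 4-7) the right-hand side of the PCT condition,
`𝒲_{n⋯1}(−x_{n−1}, …, −x₀)`, is the Wightman distribution of the reversed sequence of fields
composed with the involution `negRev : x ↦ (−x_{n−1}, …, −x₀)`. This file provides the generic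
function theory of that substitution:

* `negRev` on complex configurations, `negRevReal` on real ones, `negRevCLE` (a real continuous linear
  involution), `negRevTest` (its action `φ ↦ φ ∘ negRev` on test functions);
* `negRev` preserves the relative forward tube `𝒯ʳₙ` (`negRev_mem_relForwardTube_iff`): the successive
  differences are permuted and keep their sign;
* `HasDistributionalBoundaryValue.comp_negRev` — **boundary values of the substituted function**: if
  `F` is holomorphic-side data with boundary value `T` and invariant under all common complex
  translations (a relativized tube function), then `F ∘ negRev` has the boundary value `T ∘ negRevTest`.
  (The ray `x + itη` is mapped to the ray from `negRevReal x` in the direction `−η ∘ rev`, which lies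
  in the cone of the *relative* tube only; a common translation by `t i (η_{n−1} + η₀)` moves it back
  into the base cone, and the change of variables `x ↦ negRevReal x` preserves Lebesgue measure.)

## References

* R. F. Streater, A. S. Wightman, *PCT, Spin and Statistics, and All That* (1964; Princeton 2000),
  §4-3, Thm. 4-7 (the substitution `x ↦ −x` with reversed order of the fields). [StreaterWightman1964]
-/

noncomputable section

open Complex Set Filter MeasureTheory
open _root_.Topology
open scoped SchwartzMap

namespace Literature.MathematicalPhysics.QuantumLattice

variable {d n : ℕ}

/-! ### The substitution on configurations -/

/-- `negRev z = (−z_{n−1}, …, −z₀)` on complex configurations. [cite: StreaterWightman1964, §4-3 Thm 4-7] -/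
def negRev (z : Fin n → Fin (d + 1) → ℂ) : Fin n → Fin (d + 1) → ℂ := fun j => -z (Fin.rev j)

/-- `negRev_apply`: component formula. [folklore] -/
@[simp] theorem negRev_apply (z : Fin n → Fin (d + 1) → ℂ) (j : Fin n) : negRev z j = -z (Fin.rev j) := rfl

/-- `negRev` is an involution. [folklore] -/
@[simp] theorem negRev_negRev (z : Fin n → Fin (d + 1) → ℂ) : negRev (negRev z) = z := by
  funext j; simp [Fin.rev_rev]

/-- `negRevReal x = (−x_{n−1}, …, −x₀)` on real configurations. [cite: StreaterWightman1964, §4-3 Thm 4-7] -/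
def negRevReal (x : Fin n → SpaceTime d) : Fin n → SpaceTime d := fun j => -x (Fin.rev j)

/-- `negRevReal_apply`: component formula. [folklore] -/
@[simp] theorem negRevReal_apply (x : Fin n → SpaceTime d) (j : Fin n) : negRevReal x j = -x (Fin.rev j) := rfl

/-- `negRevReal` is an involution. [folklore] -/
@[simp] theorem negRevReal_negRevReal (x : Fin n → SpaceTime d) : negRevReal (negRevReal x) = x := by
  funext j; simp [Fin.rev_rev]

/-- `negRevReal` as a real continuous linear involution of configuration space. [folklore] -/
def negRevCLE : (Fin n → SpaceTime d) ≃L[ℝ] (Fin n → SpaceTime d) where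
  toFun := negRevReal
  invFun := negRevReal
  map_add' x y := by funext j; simp [negRevReal]; abel
  map_smul' c x := by funext j; simp [negRevReal]
  left_inv := negRevReal_negRevReal
  right_inv := negRevReal_negRevReal
  continuous_toFun := continuous_pi fun j => ((continuous_apply (Fin.rev j)).neg)
  continuous_invFun := continuous_pi fun j => ((continuous_apply (Fin.rev j)).neg)

/-- `negRevCLE x = negRevReal x`. [folklore] -/
@[simp] theorem negRevCLE_apply (x : Fin n → SpaceTime d) : negRevCLE x = negRevReal x := rfl

/-- The **PCT substitution on test functions**, `negRevTest φ = φ ∘ negRev`. [cite: StreaterWightman1964, §4-3 Thm 4-7] -/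
def negRevTest : 𝓢((Fin n → SpaceTime d), ℂ) →L[ℂ] 𝓢((Fin n → SpaceTime d), ℂ) :=
  SchwartzMap.compCLMOfContinuousLinearEquiv ℂ negRevCLE

/-- Pointwise formula: `negRevTest φ x = φ (negRevReal x)`. [folklore] -/
@[simp] theorem negRevTest_apply (φ : 𝓢((Fin n → SpaceTime d), ℂ)) (x : Fin n → SpaceTime d) :
    negRevTest φ x = φ (negRevReal x) := rfl

/-- `negRevTest` is an involution. [folklore] -/
@[simp] theorem negRevTest_negRevTest (φ : 𝓢((Fin n → SpaceTime d), ℂ)) : negRevTest (negRevTest φ) = φ := by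
  ext x; simp

/-- Complexification commutes with the substitution. [folklore] -/
theorem negRev_complexify (x : Fin n → SpaceTime d) :
    negRev (fun k => complexifyPoint (x k)) = fun k => complexifyPoint (negRevReal x k) := by
  funext j μ; simp [complexifyPoint_apply]

/-- The substitution maps rays to rays: `negRev (x + itη) = negRevReal x + it (negRevReal η)`. [folklore] -/
theorem negRev_ray (x η : Fin n → SpaceTime d) (t : ℝ) :
    negRev (fun k => complexifyPoint (x k) + ((t : ℂ) * I) • complexifyPoint (η k)) =
      fun k => complexifyPoint (negRevReal x k) + ((t : ℂ) * I) • complexifyPoint (negRevReal η k) := by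
  funext j μ
  simp [complexifyPoint_apply]
  ring

/-! ### The substitution preserves the relative forward tube -/

/-- **`negRev` preserves `𝒯ʳₙ`**: the successive differences are reversed in order and keep their
imaginary parts in `V₊`. [folklore] -/
theorem negRev_mem_relForwardTube {z : Fin n → Fin (d + 1) → ℂ} (hz : z ∈ QuantumFieldTheory.relForwardTube d n) :
    negRev z ∈ QuantumFieldTheory.relForwardTube d n := by
  cases n with
  | zero => exact fun k => k.elim0
  | succ m =>
    rw [mem_relForwardTube_succ_iff] at hz ⊢
    intro j
    have h := hz (Fin.rev j)
    simp only [negRev_apply, Fin.rev_castSucc, Fin.rev_succ]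
    convert h using 2
    abel

/-- `negRev` acts on `𝒯ʳₙ` as a bijection. [folklore] -/
theorem negRev_mem_relForwardTube_iff (z : Fin n → Fin (d + 1) → ℂ) :
    negRev z ∈ QuantumFieldTheory.relForwardTube d n ↔ z ∈ QuantumFieldTheory.relForwardTube d n :=
  ⟨fun h => by simpa using negRev_mem_relForwardTube h, negRev_mem_relForwardTube⟩

/-- `negRev` is complex differentiable. [folklore] -/
theorem differentiable_negRev : Differentiable ℂ (negRev (d := d) (n := n)) :=
  differentiable_pi.2 fun j => (differentiable_apply (Fin.rev j)).neg

/-- `negRev` commutes with common translations up to the sign: `negRev (z + c) = negRev z − c`. [folklore] -/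
theorem negRev_add_const (z : Fin n → Fin (d + 1) → ℂ) (c : Fin (d + 1) → ℂ) :
    negRev (fun k => z k + c) = fun k => negRev z k + (-c) := by
  funext j; simp [negRev]; abel

/-! ### Lebesgue measure and the substitution -/

/-- The substitution preserves Lebesgue integrals: `∫ G(negRevReal x) dx = ∫ G(y) dy`. [folklore] -/
theorem integral_comp_negRevReal {G' : Type*} [NormedAddCommGroup G'] [NormedSpace ℝ G'] (G : (Fin n → SpaceTime d) → G') :
    ∫ x : Fin n → SpaceTime d, G (negRevReal x) = ∫ y : Fin n → SpaceTime d, G y := by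
  haveI : (volume : Measure (Fin n → SpaceTime d)).IsNegInvariant := Pi.isNegInvariant_volume
  have h1 : ∫ x : Fin n → SpaceTime d, G (negRevReal x) = ∫ x : Fin n → SpaceTime d, G (-(fun k => x (Fin.rev k))) := by
    rfl
  rw [h1, QuantumFieldTheory.integral_comp_rev (fun y : Fin n → SpaceTime d => G (-y)), integral_neg_eq_self _ volume]

/-! ### Boundary values of the substituted function -/

/-- A base-cone direction for the reversed ray: `η'_j = −η_{n−1−j} + (η_{n−1} + η₀)`. [folklore] -/
def negRevDir (η : Fin n → SpaceTime d) : Fin n → SpaceTime d :=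
  fun j => -η (Fin.rev j) + ((if h : 0 < n then η ⟨n - 1, Nat.sub_lt h Nat.one_pos⟩ + η ⟨0, h⟩ else 0))

/-- The shifted reversed direction lies in the base cone. [folklore] -/
theorem negRevDir_mem_tubeCone {η : Fin n → SpaceTime d} (hη : η ∈ tubeCone d n) : negRevDir η ∈ tubeCone d n := by
  cases n with
  | zero => exact fun k => k.elim0
  | succ m =>
    intro k
    refine Fin.cases ?_ (fun j => ?_) k
    · rw [succDiff_zero]
      have h0 := hη 0
      rw [succDiff_zero] at h0
      simp only [negRevDir, Nat.zero_lt_succ, ↓reduceDIte, Fin.rev_zero]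
      convert h0 using 1
      have : (⟨m + 1 - 1, Nat.sub_lt (Nat.zero_lt_succ m) Nat.one_pos⟩ : Fin (m + 1)) = Fin.last m := by
        ext; simp
      rw [this, show (⟨0, Nat.zero_lt_succ m⟩ : Fin (m + 1)) = 0 from rfl]
      abel
    · rw [succDiff_succ]
      have h := hη (Fin.rev j.castSucc)
      have e : Fin.rev j.castSucc = (Fin.rev j).succ := Fin.rev_castSucc j
      rw [e, succDiff_succ] at h
      simp only [negRevDir]
      rw [Fin.rev_succ]
      convert h using 1
      rw [e]
      abel

/-- The reversed ray, shifted by the common translation `t i (η_{n−1} + η₀)`, is the ray from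
`negRevReal x` in the base-cone direction `negRevDir η`. [folklore] -/
theorem negRev_ray_add_shift (x η : Fin n → SpaceTime d) (t : ℝ) :
    (fun k => negRev (fun k => complexifyPoint (x k) + ((t : ℂ) * I) • complexifyPoint (η k)) k +
      ((t : ℂ) * I) • complexifyPoint (if h : 0 < n then η ⟨n - 1, Nat.sub_lt h Nat.one_pos⟩ + η ⟨0, h⟩ else 0)) =
      fun k => complexifyPoint (negRevReal x k) + ((t : ℂ) * I) • complexifyPoint (negRevDir η k) := by
  funext j μ
  simp [negRevDir, complexifyPoint_apply]
  ring

/-- **Boundary values of the PCT-substituted function**: if `F` has boundary value `T` and is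
invariant under all common complex translations, then `F ∘ negRev` has boundary value
`T ∘ negRevTest`. [cite: StreaterWightman1964, §4-3 Thm 4-7] -/
theorem HasDistributionalBoundaryValue.comp_negRev {F : (Fin n → Fin (d + 1) → ℂ) → ℂ}
    {T : 𝓢((Fin n → SpaceTime d), ℂ) →L[ℂ] ℂ} (hbv : HasDistributionalBoundaryValue F T)
    (hinv : ∀ (z : Fin n → Fin (d + 1) → ℂ) (c : Fin (d + 1) → ℂ), F (fun k => z k + c) = F z) :
    HasDistributionalBoundaryValue (fun z => F (negRev z)) (T.comp negRevTest) := by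
  intro η hη G
  have hlim := hbv (negRevDir η) (negRevDir_mem_tubeCone hη) (negRevTest G)
  rw [ContinuousLinearMap.comp_apply]
  refine hlim.congr fun t => ?_
  -- rewrite the integrand through the shift and change variables
  have hshift : ∀ x : Fin n → SpaceTime d,
      F (negRev (fun k => complexifyPoint (x k) + ((t : ℂ) * I) • complexifyPoint (η k))) =
        F (fun k => complexifyPoint (negRevReal x k) + ((t : ℂ) * I) • complexifyPoint (negRevDir η k)) := by
    intro x
    rw [← negRev_ray_add_shift x η t, hinv]
  simp only
  calc ∫ x : Fin n → SpaceTime d, F (fun k => complexifyPoint (x k) + ((t : ℂ) * I) • complexifyPoint (negRevDir η k)) *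
          negRevTest G x
      = ∫ x : Fin n → SpaceTime d, (fun y => F (fun k => complexifyPoint (negRevReal y k) +
          ((t : ℂ) * I) • complexifyPoint (negRevDir η k)) * G y) (negRevReal x) := by
        refine integral_congr_ae (Eventually.of_forall fun x => ?_)
        simp only [negRevTest_apply, negRevReal_negRevReal]
    _ = ∫ y : Fin n → SpaceTime d, F (fun k => complexifyPoint (negRevReal y k) +
          ((t : ℂ) * I) • complexifyPoint (negRevDir η k)) * G y :=
        integral_comp_negRevReal (fun y => F (fun k => complexifyPoint (negRevReal y k) +
          ((t : ℂ) * I) • complexifyPoint (negRevDir η k)) * G y)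
    _ = ∫ y : Fin n → SpaceTime d, F (negRev (fun k => complexifyPoint (y k) + ((t : ℂ) * I) • complexifyPoint (η k))) * G y := by
        refine integral_congr_ae (Eventually.of_forall fun y => ?_)
        simp only [hshift]

/-- **Holomorphy of the substituted function** on `𝒯ʳₙ`. [folklore] -/
theorem DifferentiableOn.comp_negRev {E : Type*} [NormedAddCommGroup E] [NormedSpace ℂ E]
    {F : (Fin n → Fin (d + 1) → ℂ) → E} (hF : DifferentiableOn ℂ F (QuantumFieldTheory.relForwardTube d n)) :
    DifferentiableOn ℂ (fun z => F (negRev z)) (QuantumFieldTheory.relForwardTube d n) :=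
  hF.comp differentiable_negRev.differentiableOn fun _ hz => negRev_mem_relForwardTube hz

end Literature.MathematicalPhysics.QuantumLattice
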